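import Summits.AtomisticToContinuum.FouriersLaw.Theorems.VanishingNoiseTransferVanishingNoiseBoundFlipResolventUniform

/-!
# The steady state is invariant for the resolvent kernels (helper for stub S2'
`stub_flipResponseEquidifferentiable`, line `fekete-usc-one-length`)

`--supports stmt-AtomisticToContinuum-11976` helper file (crux `VanishingNoiseBound`, route
`VanishingNoiseTransfer`). The weak flip steady state of `L + εS` at small rate is `μ = π R_{Nε}`
(`exists_isFlipSteadyState_bind_of_resolventKernel`, `…FlipSteadyStateBind.lean`) for the resolvent
kernel `R_r(z,·) = ∫₀^∞ r e^{-rt} P_t(z,·) dt` of the flip-free semigroup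
(`exists_resolventKernel_uniform`, `…FlipResolventUniform.lean`) and an invariant law `π` of the
chain embedded at the flip times. The transfer estimate of the next file
(`…FlipAsymmetryTransfer.lean`: the distance from `μ` to the steady state `μ⋆` is controlled by the
flip-ODD part of `μ⋆`) rests on two identities which those two constructions establish internally
but do not export; this file and its companion re-run them (verbatim, cited) with the identities
exposed:

* `isInvariant_resolvent` — an invariant measure of a Langevin-chain semigroup is invariant for
  every time-average `K ∘ₖ (const ρ ×ₖ id)` of its kernels over a probability law `ρ` of times
  (Tonelli), in particular for the resolvent kernels;
* `exists_resolventKernel_invariant` — `exists_resolventKernel_uniform` with the extra clause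
  `μ⋆ R_r = μ⋆` (`μ⋆.bind R = μ⋆`) for every rate `r ≤ 1`;
* (companion file `…FlipBindInvariant.lean`: `exists_isFlipSteadyState_bind_of_resolventKernel`
  with the invariance `π = (π R) Q` of the embedded law exposed).

Also exposed: the exponential moment `∫ e^{θH} dμ⋆ < ∞` of the steady state. No definitions.
-/

noncomputable section

namespace Summit.AtomisticToContinuum.FouriersLaw.Theorems.FixedLengthNoiseContinuity

open MeasureTheory ProbabilityTheory Filter Topology Set
open scoped NNReal ENNReal ContDiff BoundedContinuousFunction
open Literature.MathematicalPhysics.KineticTheory.HeatConduction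
open Literature.Probability.Process

/-! ## §1 Invariant measures are invariant for time-averaged kernels -/

/-- **An invariant measure of the semigroup is invariant for every time-average of its kernels.**
For a Langevin-chain semigroup `S`, its time-extended kernel `K (t, z) = P_{t⁺}(z, ·)`, a
probability law `ρ` of times and a finite `S`-invariant measure `μ`:
`μ (K ∘ₖ (const ρ ×ₖ id)) = μ`, i.e. `∫ (∫ P_t(z, A) ρ(dt)) μ(dz) = ∫ μ(A) ρ(dt) = μ(A)` (Tonelli).
In particular `μ⋆ R_r = μ⋆` for the resolvent kernels `R_r` (`ρ = Exp_r`). -/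
theorem isInvariant_resolvent {P : OscillatorChain} {N : ℕ} {T_L T_R : ℝ}
    (S : LangevinChainSemigroup P N T_L T_R)
    (K : Kernel (ℝ × PhaseSpace N) (PhaseSpace N)) [IsMarkovKernel K]
    (hK : ∀ (t : ℝ) (z : PhaseSpace N), K (t, z) = S.kernel t.toNNReal z)
    (ρ : Measure ℝ) [IsProbabilityMeasure ρ] {μ : Measure (PhaseSpace N)} [IsFiniteMeasure μ]
    (hμ : S.IsInvariant μ) :
    μ.bind (K ∘ₖ (Kernel.const (PhaseSpace N) ρ ×ₖ Kernel.id)) = μ := by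
  refine Measure.ext fun s hs => ?_
  rw [Measure.bind_apply hs (Kernel.aemeasurable _)]
  -- `R z s = ∫ P_t(z, s) ρ(dt)`
  have hR : ∀ z : PhaseSpace N, (K ∘ₖ (Kernel.const (PhaseSpace N) ρ ×ₖ Kernel.id)) z s =
      ∫⁻ t, K (t, z) s ∂ρ := by
    intro z
    have h := lintegral_comp_const_prod_id K ρ z (measurable_one.indicator hs)
    have e1 : ∫⁻ y, s.indicator 1 y ∂((K ∘ₖ (Kernel.const (PhaseSpace N) ρ ×ₖ Kernel.id)) z) =
        (K ∘ₖ (Kernel.const (PhaseSpace N) ρ ×ₖ Kernel.id)) z s := lintegral_indicator_one hs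
    have e2 : ∀ t : ℝ, ∫⁻ y, s.indicator 1 y ∂(K (t, z)) = K (t, z) s := fun t =>
      lintegral_indicator_one hs
    rw [e1] at h
    rw [h]
    exact lintegral_congr fun t => e2 t
  have hmeas : Measurable fun p : PhaseSpace N × ℝ => K (p.2, p.1) s :=
    (Kernel.measurable_coe K hs).comp measurable_swap
  have hinv : ∀ t : ℝ, ∫⁻ z, K (t, z) s ∂μ = μ s := fun t => by
    simp only [hK]
    exact LangevinChainSemigroup.IsInvariant.lintegral_kernel S hμ t.toNNReal hs
  calc ∫⁻ z, (K ∘ₖ (Kernel.const (PhaseSpace N) ρ ×ₖ Kernel.id)) z s ∂μ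
      = ∫⁻ z, ∫⁻ t, K (t, z) s ∂ρ ∂μ := lintegral_congr hR
    _ = ∫⁻ t, ∫⁻ z, K (t, z) s ∂μ ∂ρ := lintegral_lintegral_swap hmeas.aemeasurable
    _ = ∫⁻ _t, μ s ∂ρ := lintegral_congr hinv
    _ = μ s := by rw [lintegral_const, measure_univ, mul_one]

/-! ## §2 The resolvent kernels at rates `r ≤ 1`, with the invariance of the steady state -/

section Pinned

variable {ω₂ lam β γ : ℝ} {N : ℕ} {T_L T_R : ℝ}

/-- **`exists_resolventKernel_uniform` with the invariance `μ⋆ R_r = μ⋆` exposed.** For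
`pinnedChain ω₂ lam β γ` (all parameters `> 0`), `N ≥ 2`, `T_L, T_R > 0`, `θ = 1/(2 max(T_L,T_R))`:
the steady state `μ⋆` of the transition semigroup (a probability measure, a weak `IsSteadyState`),
constants `a < 1`, `b < ∞`, `M ≥ 0`, and for every rate `0 < r ≤ 1` a Markov kernel `R` (the
resolvent `R_r`) with: (o) `μ⋆.bind R = μ⋆`; (i) the resolvent identity on `C_c^∞`; (ii) Feller;
(iii) `∫ e^{θH} dR(z,·) ≤ a e^{θH(z)} + b`; (iv) `|∫ g dR(z,·) - ∫ g dμ⋆| ≤ M r e^{θH(z)}` for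
continuous `|g| ≤ e^{θH}`; and `∫ e^{θH} dμ⋆ < ∞`. Proof: that of `exists_resolventKernel_uniform`
(`…FlipResolventUniform.lean`) verbatim, plus `isInvariant_resolvent` for clause (o). -/
theorem exists_resolventKernel_invariant (hω : 0 < ω₂) (hl : 0 < lam) (hβ : 0 < β) (hγ : 0 < γ)
    (hN : 1 < N) (hTL : 0 < T_L) (hTR : 0 < T_R) :
    ∃ μs : Measure (PhaseSpace N), IsProbabilityMeasure μs ∧
      (pinnedChain ω₂ lam β γ).IsSteadyState N T_L T_R μs ∧
      ∫⁻ y, ENNReal.ofReal (Real.exp (1 / max T_L T_R / 2 *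
        (pinnedChain ω₂ lam β γ).hamiltonian N y)) ∂μs ≠ ⊤ ∧
      ∃ (a b : ℝ≥0∞) (M : ℝ), a < 1 ∧ b ≠ ⊤ ∧ 0 ≤ M ∧
        ∀ r : ℝ, 0 < r → r ≤ 1 →
          ∃ R : Kernel (PhaseSpace N) (PhaseSpace N), IsMarkovKernel R ∧
            μs.bind R = μs ∧
            (∀ f : PhaseSpace N → ℝ, ContDiff ℝ ∞ f → HasCompactSupport f → ∀ z : PhaseSpace N,
              ∫ y, (pinnedChain ω₂ lam β γ).generator N T_L T_R f y ∂(R z) =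
                r * (∫ y, f y ∂(R z) - f z)) ∧
            (∀ g : PhaseSpace N →ᵇ ℝ, Continuous fun z => ∫ y, g y ∂(R z)) ∧
            (∀ z : PhaseSpace N,
              ∫⁻ y, ENNReal.ofReal (Real.exp (1 / max T_L T_R / 2 *
                  (pinnedChain ω₂ lam β γ).hamiltonian N y)) ∂(R z) ≤
                a * ENNReal.ofReal (Real.exp (1 / max T_L T_R / 2 *
                  (pinnedChain ω₂ lam β γ).hamiltonian N z)) + b) ∧
            (∀ g : PhaseSpace N → ℝ, Continuous g →
              (∀ y, |g y| ≤ Real.exp (1 / max T_L T_R / 2 *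
                (pinnedChain ω₂ lam β γ).hamiltonian N y)) →
              ∀ z : PhaseSpace N, |∫ y, g y ∂(R z) - ∫ y, g y ∂μs| ≤
                M * r * Real.exp (1 / max T_L T_R / 2 *
                  (pinnedChain ω₂ lam β γ).hamiltonian N z)) := by
  -- adapted from `exists_resolventKernel_uniform`
  -- (Summits/…/VanishingNoiseTransferVanishingNoiseBoundFlipResolventUniform.lean), itself adapted from
  -- `pinnedChain_exists_resolventKernel` (Literature/…/LangevinChainResolvent.lean): verbatim, plus (o)
  have hN0 : 0 < N := by omega
  set P := pinnedChain ω₂ lam β γ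
  set θ : ℝ := 1 / max T_L T_R / 2 with hθdef
  have hmax : 0 < max T_L T_R := lt_max_of_lt_left hTL
  have hθ : 0 < θ := by positivity
  have hθ' : θ < 1 / max T_L T_R := half_lt_self (by positivity)
  set Sg := pinnedChainSemigroup hω hl.le hβ.le hγ.le hN0 hTL.le hTR.le
  -- the steady state of the semigroup and the exponential convergence (2.5) at weight `e^{θH}`
  obtain ⟨-, μs, hμs, hinv, hrest⟩ := pinnedChainSemigroup_ergodic hω hl.le hβ hγ hN0 hTL hTR
  obtain ⟨hint, C25, c25, hC25, hc25, h25⟩ := hrest θ hθ hθ'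
  haveI := hμs
  have hss : P.IsSteadyState N T_L T_R μs :=
    pinnedChain_isSteadyState_of_isInvariant hω.le hl.le hβ.le γ N Sg hinv hθ hint
  -- the time-extended kernel
  let K : Kernel (ℝ × PhaseSpace N) (PhaseSpace N) := ⟨fun p => Sg.kernel p.1.toNNReal p.2,
    Measurable.comp (g := fun q : ℝ≥0 × PhaseSpace N => Sg.kernel q.1 q.2)
      (f := fun p : ℝ × PhaseSpace N => (p.1.toNNReal, p.2)) Sg.measurable_kernel (by fun_prop)⟩
  haveI hKM : IsMarkovKernel K :=
    ⟨fun p => by change IsProbabilityMeasure (Sg.kernel p.1.toNNReal p.2); infer_instance⟩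
  have hK : ∀ (t : ℝ) (z : PhaseSpace N), K (t, z) = Sg.kernel t.toNNReal z := fun t z => rfl
  -- Lyapunov constants, with the time step frozen at `r₀ = 1`
  set Cst : ℝ := θ * γ * (T_L + T_R) with hCst
  have hCst0 : 0 ≤ Cst := by positivity
  set ts : ℝ := 1 / (8 * (Cst + 1 + 1)) with hts
  have hts0 : 0 < ts := by positivity
  have hkey : (Cst + 1 + 1) * ts = 1 / 8 := by rw [hts]; field_simp
  have hCts : Cst * ts ≤ 1 / 8 := hkey ▸ mul_le_mul_of_nonneg_right (by linarith) hts0.le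
  have h1ts : ts ≤ 1 / 8 := by
    have : 1 * ts ≤ (Cst + 1 + 1) * ts := mul_le_mul_of_nonneg_right (by linarith) hts0.le
    linarith
  set tstar : ℝ≥0 := ⟨ts, hts0.le⟩
  have htsco : ((tstar : ℝ≥0) : ℝ) = ts := rfl
  have hts0' : (0 : ℝ≥0) < tstar := by rw [← NNReal.coe_lt_coe]; exact hts0
  set V : PhaseSpace N → ℝ≥0∞ := fun y => ENNReal.ofReal (Real.exp (θ * P.hamiltonian N y)) with hV
  have hVm : Measurable V := ENNReal.measurable_ofReal.comp (Real.measurable_exp.comp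
    ((pinnedChain_continuous_hamiltonian ω₂ lam β γ N).measurable.const_mul _))
  have h34 := lintegral_exp_mul_hamiltonian_pinnedChainSemigroup_le hω hl.le hβ.le hγ.le hN0 hTL.le
    hTR.le hTL hTR hθ hθ'
  obtain ⟨E₀, hE₀⟩ := pinnedChain_lintegral_exp_hamiltonian_small hω hl hβ hγ hN hTL hTR hθ hθ'
    (tstar := (tstar : ℝ)) (by rw [htsco]; exact hts0)
  set c₀ : ℝ := Real.exp (Cst * ts) * Real.exp (θ * E₀) with hc₀
  set a₀ : ℝ≥0∞ := ENNReal.ofReal (1 / 2) with ha₀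
  have hH2 : ∀ x, ∫⁻ y, V y ∂(Sg.kernel tstar x) ≤ a₀ * V x + ENNReal.ofReal c₀ := by
    intro x
    change ∫⁻ y, V y ∂(P.transitionKernel N T_L T_R tstar x) ≤ _
    by_cases hx : P.hamiltonian N x ≤ E₀
    · refine (h34 tstar x).trans (le_add_left (ENNReal.ofReal_le_ofReal ?_))
      rw [hc₀, htsco]
      exact mul_le_mul_of_nonneg_left (Real.exp_le_exp.2 (mul_le_mul_of_nonneg_left hx hθ.le))
        (Real.exp_pos _).le
    · rw [pinnedChain_lintegral_transitionKernel hω hl.le hβ.le hγ.le N T_L T_R tstar x hVm]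
      refine (hE₀ x (le_of_not_ge hx)).trans (le_add_right (le_of_eq ?_))
      rw [ha₀, hV, ← ENNReal.ofReal_mul (by norm_num)]
      congr 1; ring
  set c : ℝ≥0∞ := ENNReal.ofReal (Real.exp (Cst * ts)) with hc
  have hloc : ∀ u : ℝ≥0, u < tstar → ∀ x, ∫⁻ y, V y ∂(Sg.kernel u x) ≤ c * V x := by
    intro u hu x
    refine (h34 u x).trans ?_
    rw [hc, hV, ← ENNReal.ofReal_mul (by positivity)]
    refine ENNReal.ofReal_le_ofReal (mul_le_mul_of_nonneg_right (Real.exp_le_exp.2 ?_) (by positivity))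
    have hu' : ((u : ℝ≥0) : ℝ) ≤ ts := by rw [← htsco]; exact_mod_cast hu.le
    rw [hCst]
    nlinarith [u.coe_nonneg]
  have ha₀1 : a₀ < 1 := ENNReal.ofReal_lt_one.2 (by norm_num)
  obtain ⟨B, hBtop, hB⟩ := MarkovSemigroup.exists_fixedBound ha₀1 ENNReal.ofReal_ne_top
  have hunif : ∀ (t : ℝ≥0) x, ∫⁻ y, V y ∂(Sg.kernel t x) ≤ c * V x + B := fun t x =>
    MarkovSemigroup.lintegral_kernel_le_of_lyapunov Sg.kernel Sg.kernel_zero Sg.kernel_add hVm hts0'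
      ha₀1.le hB hH2 hloc t x
  -- the exponential moment of the steady state
  have hμsV : ∫⁻ y, V y ∂μs ≠ ⊤ := by
    have h := hint.2
    rw [hasFiniteIntegral_iff_enorm] at h
    simp only [Real.enorm_eq_ofReal (Real.exp_nonneg _)] at h
    exact h.ne
  -- the uniform constants
  refine ⟨μs, hμs, hss, hμsV, c * ENNReal.ofReal ts + c * a₀, B + (c * ENNReal.ofReal c₀ + B),
    C25 / c25, ?_, ?_, by positivity, fun r hr hr1 => ?_⟩
  · rw [hc, ha₀, ← ENNReal.ofReal_mul (Real.exp_pos _).le, ← ENNReal.ofReal_mul (Real.exp_pos _).le,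
      ← ENNReal.ofReal_add (by positivity) (by positivity), ENNReal.ofReal_lt_one]
    have h1 : Real.exp (Cst * ts) * (1 - Cst * ts) ≤ 1 := by
      have := Real.add_one_le_exp (-(Cst * ts))
      calc Real.exp (Cst * ts) * (1 - Cst * ts) ≤ Real.exp (Cst * ts) * Real.exp (-(Cst * ts)) :=
            mul_le_mul_of_nonneg_left (by linarith) (Real.exp_pos _).le
        _ = 1 := by rw [← Real.exp_add, add_neg_cancel, Real.exp_zero]
    nlinarith [Real.exp_pos (Cst * ts), mul_nonneg hCst0 hts0.le]
  · exact ENNReal.add_ne_top.2 ⟨hBtop, ENNReal.add_ne_top.2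
      ⟨ENNReal.mul_ne_top ENNReal.ofReal_ne_top ENNReal.ofReal_ne_top, hBtop⟩⟩
  -- the resolvent kernel at rate `r`
  haveI := isProbabilityMeasure_expMeasure hr
  set ρ := expMeasure r
  have hly : ∀ z : PhaseSpace N, ∫⁻ y, V y ∂((K ∘ₖ (Kernel.const (PhaseSpace N) ρ ×ₖ Kernel.id)) z) ≤
      (c * ENNReal.ofReal ts + c * a₀) * V z + (B + (c * ENNReal.ofReal c₀ + B)) := by
    intro z
    have h₁ : ∀ t : ℝ, ∫⁻ y, V y ∂(K (t, z)) ≤ c * V z + B := fun t => hunif t.toNNReal z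
    have h₂ : ∀ t : ℝ, ts ≤ t →
        ∫⁻ y, V y ∂(K (t, z)) ≤ c * a₀ * V z + (c * ENNReal.ofReal c₀ + B) := fun t ht =>
      Sg.lintegral_kernel_le_of_tstar_le K hK hVm hH2 hunif (by rw [htsco]; exact ht) z
    refine (lintegral_comp_const_prod_id_le K ρ z hVm ts h₁ h₂).trans ?_
    gcongr
    refine (expMeasure_Iio_le hr hts0.le).trans (ENNReal.ofReal_le_ofReal ?_)
    calc r * ts ≤ 1 * ts := mul_le_mul_of_nonneg_right hr1 hts0.le
      _ = ts := one_mul ts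
  refine ⟨K ∘ₖ (Kernel.const (PhaseSpace N) ρ ×ₖ Kernel.id), inferInstance,
    isInvariant_resolvent Sg K hK ρ hinv, fun f hf hfc z =>
    Sg.integral_generator_comp_const_prod_id K hK (pinnedChain_contDiff_U ω₂ lam β γ)
      (pinnedChain_contDiff_V ω₂ lam β γ) hr hf hfc z, fun g => Sg.continuous_integral_comp_const_prod_id
      K hK ρ (continuous_act_pinnedChainSemigroup hω hl.le hβ.le hγ.le hN0 hTL.le hTR.le) g, hly, ?_⟩
  -- (iv) the distance to the steady state, `abs_integral_resolvent_sub_le`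
  intro g hg hgb z
  have hVz : ∫⁻ y, V y ∂((K ∘ₖ (Kernel.const (PhaseSpace N) ρ ×ₖ Kernel.id)) z) < ⊤ := by
    refine (hly z).trans_lt (ENNReal.add_lt_top.2 ⟨ENNReal.mul_lt_top ?_ ENNReal.ofReal_lt_top, ?_⟩)
    · exact ENNReal.add_lt_top.2 ⟨ENNReal.mul_lt_top ENNReal.ofReal_lt_top ENNReal.ofReal_lt_top,
        ENNReal.mul_lt_top ENNReal.ofReal_lt_top ENNReal.ofReal_lt_top⟩
    · exact ENNReal.add_lt_top.2 ⟨hBtop.lt_top, ENNReal.add_lt_top.2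
        ⟨ENNReal.mul_lt_top ENNReal.ofReal_lt_top ENNReal.ofReal_lt_top, hBtop.lt_top⟩⟩
  have hexpi : Integrable (fun y => Real.exp (θ * P.hamiltonian N y))
      ((K ∘ₖ (Kernel.const (PhaseSpace N) ρ ×ₖ Kernel.id)) z) := by
    refine ⟨(Real.continuous_exp.comp (continuous_const.mul
      (pinnedChain_continuous_hamiltonian ω₂ lam β γ N))).aestronglyMeasurable, ?_⟩
    show ∫⁻ y, ‖Real.exp (θ * P.hamiltonian N y)‖ₑ
      ∂((K ∘ₖ (Kernel.const (PhaseSpace N) ρ ×ₖ Kernel.id)) z) < ⊤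
    simp only [Real.enorm_eq_ofReal (Real.exp_nonneg _)]
    exact hVz
  have hgi : Integrable g ((K ∘ₖ (Kernel.const (PhaseSpace N) ρ ×ₖ Kernel.id)) z) :=
    hexpi.mono' hg.aestronglyMeasurable (Eventually.of_forall fun y => by
      rw [Real.norm_eq_abs]; exact hgb y)
  have hA : 0 ≤ C25 * Real.exp (θ * P.hamiltonian N z) := by positivity
  have hb : ∀ t : ℝ≥0, |Sg.act t g z - ∫ y, g y ∂μs| ≤
      C25 * Real.exp (θ * P.hamiltonian N z) * Real.exp (-c25 * t) := fun t => h25 z t g hg hgb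
  have key := abs_integral_resolvent_sub_le Sg K hK hr hg.stronglyMeasurable z hgi hA hc25 hb
  refine key.trans ?_
  have hrc : r / (r + c25) ≤ r / c25 :=
    div_le_div_of_nonneg_left hr.le hc25 (by linarith)
  calc C25 * Real.exp (θ * P.hamiltonian N z) * (r / (r + c25))
      ≤ C25 * Real.exp (θ * P.hamiltonian N z) * (r / c25) :=
        mul_le_mul_of_nonneg_left hrc hA
    _ = C25 / c25 * r * Real.exp (θ * P.hamiltonian N z) := by ring


/-- Registered helper sub-goal `helper_flipResolventInvariant` of stmt-AtomisticToContinuum-11976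
(= `exists_resolventKernel_invariant`, fully quantified, notation-free one-line form). -/
theorem helper_flipResolventInvariant : ∀ (ω₂ lam β γ : ℝ), 0 < ω₂ → 0 < lam → 0 < β → 0 < γ → ∀ (N : ℕ) (T_L T_R : ℝ), 1 < N → 0 < T_L → 0 < T_R → ∃ μs : MeasureTheory.Measure (Literature.MathematicalPhysics.KineticTheory.HeatConduction.PhaseSpace N), MeasureTheory.IsProbabilityMeasure μs ∧ (Literature.MathematicalPhysics.KineticTheory.HeatConduction.pinnedChain ω₂ lam β γ).IsSteadyState N T_L T_R μs ∧ MeasureTheory.lintegral μs (fun y => ENNReal.ofReal (Real.exp (1 / max T_L T_R / 2 * (Literature.MathematicalPhysics.KineticTheory.HeatConduction.pinnedChain ω₂ lam β γ).hamiltonian N y))) ≠ (⊤ : ENNReal) ∧ ∃ (a b : ENNReal) (M : ℝ), a < 1 ∧ b ≠ (⊤ : ENNReal) ∧ 0 ≤ M ∧ ∀ r : ℝ, 0 < r → r ≤ 1 → ∃ R : ProbabilityTheory.Kernel (Literature.MathematicalPhysics.KineticTheory.HeatConduction.PhaseSpace N) (Literature.MathematicalPhysics.KineticTheory.HeatConduction.PhaseSpace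 N), ProbabilityTheory.IsMarkovKernel R ∧ μs.bind R = μs ∧ (∀ f : Literature.MathematicalPhysics.KineticTheory.HeatConduction.PhaseSpace N → ℝ, ContDiff ℝ ((⊤ : ℕ∞) : WithTop ℕ∞) f → HasCompactSupport f → ∀ z : Literature.MathematicalPhysics.KineticTheory.HeatConduction.PhaseSpace N, MeasureTheory.integral (R z) (fun y => (Literature.MathematicalPhysics.KineticTheory.HeatConduction.pinnedChain ω₂ lam β γ).generator N T_L T_R f y) = r * (MeasureTheory.integral (R z) (fun y => f y) - f z)) ∧ (∀ g : BoundedContinuousFunction (Literature.MathematicalPhysics.KineticTheory.HeatConduction.PhaseSpace N) ℝ, Continuous fun z => MeasureTheory.integral (R z) (fun y => g y)) ∧ (∀ z : Literature.MathematicalPhysics.KineticTheory.HeatConduction.PhaseSpace N, MeasureTheory.lintegral (R z) (fun y => ENNReal.ofReal (Real.exp (1 / max T_L T_R / 2 * (Literature.MathematicalPhysics.KineticTheory.HeatConduction.pinnedChain ω₂ lam β γ).hamiltonian N y))) ≤ a * ENNReal.ofReal (Real.exp (1 / max T_L T_R / 2 * (Literature.MathematicalPhysics.KineticTheory.HeatConduction.pinnedChain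 ω₂ lam β γ).hamiltonian N z)) + b) ∧ (∀ g : Literature.MathematicalPhysics.KineticTheory.HeatConduction.PhaseSpace N → ℝ, Continuous g → (∀ y, |g y| ≤ Real.exp (1 / max T_L T_R / 2 * (Literature.MathematicalPhysics.KineticTheory.HeatConduction.pinnedChain ω₂ lam β γ).hamiltonian N y)) → ∀ z : Literature.MathematicalPhysics.KineticTheory.HeatConduction.PhaseSpace N, |MeasureTheory.integral (R z) (fun y => g y) - MeasureTheory.integral μs (fun y => g y)| ≤ M * r * Real.exp (1 / max T_L T_R / 2 * (Literature.MathematicalPhysics.KineticTheory.HeatConduction.pinnedChain ω₂ lam β γ).hamiltonian N z)) :=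
  fun _ _ _ _ hω hl hβ hγ _ _ _ hN hTL hTR => exists_resolventKernel_invariant hω hl hβ hγ hN hTL hTR

end Pinned

end Summit.AtomisticToContinuum.FouriersLaw.Theorems.FixedLengthNoiseContinuity

end
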